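import Summits.CriticalPhenomena.CardyFormulaZ2.Theses.CardyRotToConf
import Literature.Probability.RandomPlanarGeometry.StarShiftSubordination
import HarnessLib

/-!
# `L` is additive under subordination: stub `stub_starShiftSubordination` of
# `CardyRotToConfR2SymmetryUpgrade` (stmt-CriticalPhenomena-0698), line `germ-label-transport`

Brick (b1) of the locality stub `stub_isLocal`: for `*`-hulls `A' ⊆ A` the hydrodynamic
constants `L_B = starShift B` (`E_B(z) = z + L_B + o(1)` at `∞`) satisfy
`L_A = L_{A'} + L_Q` with `Q = quotientHull A A' (starRMap A' hA') = cl Φ_{A'}((A ∖ A') ∩ ℍ)` the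
quotient hull (`Φ_A = Φ_Q ∘ Φ_{A'}`, [LSW 2003] §2 p. 8). This is the bookkeeping of the constant
in the image driving function `W̃_t = W_t + L_A − L_{B_t}` of [LSW 2003] §5. One-line wrapper of
`Literature.Probability.RandomPlanarGeometry.starShift_eq_add_starShift_quotientHull`
(`StarShiftSubordination.lean`).

References: G. F. Lawler, O. Schramm, W. Werner, *Conformal restriction: the chordal case*,
J. Amer. Math. Soc. 16 (2003), §2 p. 8 and §5; G. F. Lawler, *Conformally Invariant Processes in
the Plane* (2005), §3.4 Prop. 3.36.
-/

noncomputable section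

namespace Summit.CriticalPhenomena.CardyFormulaZ2.Theorems.CardyRotToConfR2SymmetryUpgrade

open Literature.Probability.RandomPlanarGeometry
open Literature.Probability.RandomPlanarGeometry.Loewner

/-- **`L` is additive under subordination** (brick (b1) of `stub_isLocal`): for `*`-hulls
`A' ⊆ A`, `L_A = L_{A'} + L_Q` with `Q` the quotient hull of the canonical map `Φ_{A'}`.
[cite: LawlerSchrammWerner2003Restriction, §2 p. 8 (Semigroups) with §5] -/
theorem stub_starShiftSubordination : ∀ {A A' : Set ℂ} (hA : IsStarHull A) (hA' : IsStarHull A'),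
    A' ⊆ A → starShift A = starShift A' + starShift (quotientHull A A' (starRMap A' hA')) :=
  fun hA hA' h ↦ starShift_eq_add_starShift_quotientHull hA hA' h

end Summit.CriticalPhenomena.CardyFormulaZ2.Theorems.CardyRotToConfR2SymmetryUpgrade

end
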